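import Mathlib.Tactic.IntervalCases
import Summits.CriticalPhenomena.PercolationContinuityZ3.Theorems.PercNearOneGluingNoHeavyLowerTailSahiAbsorbedHeadBlocks
import Summits.CriticalPhenomena.PercolationContinuityZ3.Theorems.PercNearOneGluingNoHeavyLowerTailSahiSlotPatternTwo
import Summits.CriticalPhenomena.PercolationContinuityZ3.Theorems.PercNearOneGluingNoHeavyLowerTailSahiSlotPatternTwoDim

/-!
# Negative dependence across a gap on product grids: `E_{n+1}(1_W, 1_{U_1}, …, 1_{U_n}) ≤ 0` when `W` misses some `U_j`

Support file (lane `prim-masterthm-p3`, generation 18; `--supports stmt-CriticalPhenomena-4575`).  Pure proofs, no definitions,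
no `sorry`, standard axioms.

The value-level SIGN⁻ law `SahiAbsorbed.sahiE_setInd_cons_nonpos_of_disjoint` (head killed by a member + Sahi-positive tail
sub-families ⟹ `E_{n+1} ≤ 0`) specialised to PRODUCT WEIGHTS ON GRIDS `Y^d`, where Sahi positivity of the tail sub-families of
up-set indicators is supplied by the slot table (`sahiE_gridW_indicator_nonneg` from `SlotPatternPos d k`):
* `sahiE_gridW_cons_nonpos_of_disjoint`: for every product probability weight on `Y^d`, up-sets `U_1,…,U_n`, and ANY event `W`
  with `W ∩ U_{j₀} = ∅`: `E_{n+1}(1_W, 1_{U_1},…,1_{U_n}) ≤ 0`, provided `SlotPatternPos d k` for `1 ≤ k ≤ n`;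
* unconditional corollaries: every order on grids of dimension `≤ 2` (`…_of_dim_le_two`, gen 16's two-chain theorem in slot form),
  and order `n + 1 ≤ 3` in every dimension (`…_of_le_two`, reflected Kleitman).
So on a two-dimensional product grid an event lying in a GAP of an increasing family is negatively `E_{n+1}`-correlated with it at
every order — the value shadow of the C-slot SIGN law. [this work]
-/

namespace Summit.CriticalPhenomena.PercolationContinuityZ3.Theorems

open Finset Function Equiv Equiv.Perm
open Literature.Combinatorics.Sahi2008 Literature.Combinatorics.Sahi2008.CycleForm

namespace SahiSlot

section GridSign

open scoped Classical

variable {d n : ℕ} {Y : Type*} [LinearOrder Y] [Fintype Y]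

/-- Sahi positivity of a sub-family of up-set indicators under a product grid weight, in cycle form, from the slot cell of its
size. [this work] -/
theorem cycleSum_gridW_subfamily_nonneg (g : Fin d → Y → ℝ) (hg0 : ∀ a y, 0 ≤ g a y) (hg1 : ∀ a, ∑ y, g a y = 1)
    (U : Fin n → Finset (Fin d → Y)) (hU : ∀ j, IsUpperSet (U j : Set (Fin d → Y))) (A : Finset (Fin n)) (hA : A.Nonempty)
    (hP : SlotPatternPos d A.card) :
    0 ≤ cycleSum (gridW g) (fun j : {x // x ∈ A} => setInd (U j)) := by
  set e : Fin A.card ≃ {x // x ∈ A} := (A.orderIsoOfFin rfl).toEquiv with he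
  rw [← cycleSum_comp_equiv (gridW g) e, ← sahiE_eq_cycleSum (gridW g) (Nat.one_le_iff_ne_zero.2 (by
    rw [Nat.ne_zero_iff_zero_lt]; exact hA.card_pos)) (fun i => setInd (U (e i)))]
  exact sahiE_gridW_indicator_nonneg hP g hg0 hg1 (fun i => U (e i)) fun i => hU _

/-- **Negative dependence across a gap, every product grid** (given the lower slot cells): `W ∩ U_{j₀} = ∅` ⟹
`E_{n+1}(1_W, 1_{U_1}, …, 1_{U_n}) ≤ 0`. [this work] -/
theorem sahiE_gridW_cons_nonpos_of_disjoint (hP : ∀ k, 1 ≤ k → k ≤ n → SlotPatternPos d k)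
    (g : Fin d → Y → ℝ) (hg0 : ∀ a y, 0 ≤ g a y) (hg1 : ∀ a, ∑ y, g a y = 1)
    (W : Finset (Fin d → Y)) (U : Fin n → Finset (Fin d → Y)) (hU : ∀ j, IsUpperSet (U j : Set (Fin d → Y)))
    (j₀ : Fin n) (hW : Disjoint W (U j₀)) :
    sahiE (gridW g) (n + 1) (Fin.cons (setInd W) (fun j => setInd (U j))) ≤ 0 := by
  refine SahiAbsorbed.sahiE_setInd_cons_nonpos_of_disjoint (gridW g) (fun x => gridW_nonneg hg0 x) W U j₀ hW fun A hA => ?_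
  have hAne : A.Nonempty := ⟨j₀, hA⟩
  refine cycleSum_gridW_subfamily_nonneg g hg0 hg1 U hU A hAne (hP _ hAne.card_pos ?_)
  calc A.card ≤ (univ : Finset (Fin n)).card := card_le_card (subset_univ _)
    _ = n := by rw [card_univ, Fintype.card_fin]

/-- **Unconditional on grids of dimension `≤ 2`, every order.** [this work] -/
theorem sahiE_gridW_cons_nonpos_of_disjoint_of_dim_le_two (hd : d ≤ 2)
    (g : Fin d → Y → ℝ) (hg0 : ∀ a y, 0 ≤ g a y) (hg1 : ∀ a, ∑ y, g a y = 1)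
    (W : Finset (Fin d → Y)) (U : Fin n → Finset (Fin d → Y)) (hU : ∀ j, IsUpperSet (U j : Set (Fin d → Y)))
    (j₀ : Fin n) (hW : Disjoint W (U j₀)) :
    sahiE (gridW g) (n + 1) (Fin.cons (setInd W) (fun j => setInd (U j))) ≤ 0 :=
  sahiE_gridW_cons_nonpos_of_disjoint (fun k _ _ => slotPatternPos_of_dim_le_two hd k) g hg0 hg1 W U hU j₀ hW

/-- **Unconditional at order `≤ 3` in every dimension** (tail of size `≤ 2`: reflected Kleitman). [this work] -/
theorem sahiE_gridW_cons_nonpos_of_disjoint_of_le_two (hn : n ≤ 2)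
    (g : Fin d → Y → ℝ) (hg0 : ∀ a y, 0 ≤ g a y) (hg1 : ∀ a, ∑ y, g a y = 1)
    (W : Finset (Fin d → Y)) (U : Fin n → Finset (Fin d → Y)) (hU : ∀ j, IsUpperSet (U j : Set (Fin d → Y)))
    (j₀ : Fin n) (hW : Disjoint W (U j₀)) :
    sahiE (gridW g) (n + 1) (Fin.cons (setInd W) (fun j => setInd (U j))) ≤ 0 := by
  refine sahiE_gridW_cons_nonpos_of_disjoint (fun k hk1 hkn => ?_) g hg0 hg1 W U hU j₀ hW
  have hk2 : k ≤ 2 := hkn.trans hn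
  interval_cases k
  · exact slotPatternPos_one d
  · exact slotPatternPos_two d

end GridSign

end SahiSlot

end Summit.CriticalPhenomena.PercolationContinuityZ3.Theorems
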